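import Summits.BirchSwinnertonDyer.BirchSwinnertonDyer.Theorems.AlignedTransportAtTwoMainConjectureOfRankZeroBSDAtTwoCubicSplitStratumLayerTwoGeneralRelationDoor
import Summits.BirchSwinnertonDyer.BirchSwinnertonDyer.Theorems.AlignedTransportAtTwoMainConjectureOfRankZeroBSDAtTwoCubicCarrierRoad
import Summits.BirchSwinnertonDyer.BirchSwinnertonDyer.Theorems.AlignedTransportAtTwoMainConjectureOfRankZeroBSDAtTwoCubicSplitStratumSeedN12261
import Literature.NumberTheory.NumberFields.CubicFieldIntegers
import Literature.NumberTheory.NumberFields.CubicFieldResiduePrimes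
import HarnessLib

/-!
# Route `AlignedTransportAtTwo`, crux C2 `MainConjectureOfRankZeroBSDAtTwo` (stmt-BirchSwinnertonDyer-22298):
# ROW `N = 12261` — A SPLIT-STRATUM SEED OF THE LARGE-REGULATOR FIELD `−4087` (Dedekind-type, regulator `≈ 32.4`) BY THE GENERAL RELATION ROAD
# AT LAYER TWO, LINEAR SHAPE: ★★★ **`rank₂ Cl(K_m) ≤ 1 ∀ m`, `μ₂ = 0`, `λ₂ ≤ 1` — UNCONDITIONALLY — for every cyclotomic `ℤ₂`-extension of the cubic `2`-torsion
# field `ℚ(β)` of `⟨1, 1, 0, -430, -15761⟩`**, from ONE relation `c³·σc = 1` in `Cl(K_2)`, `K_2 = ℚ(β)·ℚ(ζ₁₆)⁺` (`3 + X = (X − 1) + 2·2`, `d = 1`)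

HONEST FRAMING (cell `bsd-f1-sign2`, WIDTH-5 attached prover seat `bsd-line-att-p4` gen 47 on line `birth` of the lead `bsd-line-att-p2`;
`--supports` stmt-BirchSwinnertonDyer-22298, closes nothing; BSD is NOT proved by any of this; the crux C2, its verdict «blocked-on
`Rank1Residual.GreenbergMuConjectureIrreducible`» and every registered stub are untouched).  THEOREMS ONLY (no `def`, no named fact, no instance, no `sorry`).

WHAT.  `W = ⟨1, 1, 0, -430, -15761⟩` (`N = 12261`, `Δ_min ≡ 1 (mod 8)`: ON the Kilford stratum; cubic `2`-torsion field `K = ℚ(β) = ℚ(θ)`, `θ³ − 7θ² + 18θ + 8 = 0`,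
`𝓞_K = ℤ ⊕ ℤθ ⊕ ℤδ`, `δ = (θ² + θ)/2`, `h_K = 1`, fundamental unit `ε = -1226625 − 3717338θ + 1697040δ` of height `≈ e^{32.4}` — this seat's `CubicDisc4087` and
`…CubicSplitStratumSeedN12261`) is a seed of att-p3 g53's split-stratum census with `r = 1` whose layer-two relation shape att-p4 g46 left UNDECIDED («random-weight
LLL too weak» against a regulator of this size).  THIS GEN decided it by INDEX CALCULUS in the degree-`12` field `K_2` (att-p3 g55's `−1727` engine made field-generic:
a `≈ 58`-prime degree-one/degree-two factor base, `≈ 5800` relations in `60 s`, the rank-`7` unit log-lattice from the relation kernel, and the generator read off by a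
twisted LLL at the log profile predicted from the relation solution; pure stdlib python on the seat): the four classes `σ^i c`, `c = [𝔮]`, generate a CYCLIC group of
order `4` on which `σ` acts TRIVIALLY (relation rows `(1,0,0,3), (0,1,0,3), (0,0,1,3), (0,0,0,4)`), so **`𝔮³·σ𝔮 = (y)`** — the LINEAR shape `3 + X = (X−1)·1 + 2·2`,
`d = 1`, exactly as for the small-regulator fields `−1559`, `−2071` of g46.  WHAT FIRES: att-p4 g46's GENERAL layer-two coordinate door
`…CubicSplitStratumLayerTwoGeneralRelationDoor` (Literature `ClassicalMuVanishesLayerTwoGeneralRelationCertificateTwoSplit`): `q₀ = -4667 + 1878θ − 448δ` (norm `-17`, `(q₀) = (17, θ − 14)` maximal,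
`q₀ ≡ −3 (mod 𝔭₁³)`), `t = 5`, `𝔮 = (q₀, s₂ − 5)`, exponents `e = (3, 1, 0, 0)`,
`y = [[308215, -124024, 29586], [358730, -144351, 34435], [90508, -36420, 8688], [248095, -99832, 23815]]` on `(1, s₁, s₂, s₁s₂) × (1, θ, δ)` (coordinates `≤ 358730`; `N_{K_2/K}(y) = q₀⁴`);
memberships `y ∈ 𝔮³` (`y = λq₀³ + μ(s₂ − 5)³`) and `y ∈ σ𝔮` (`y = λ'q₀ + μ'(σs₂ − 5)`) as ring identities in `𝓞_K[s₁,s₂]`; coprimality of the four conjugates by three Bézouts in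
`𝓞_K`; the unit `ε` is `≡ −1 (mod 𝔭₁³)` at `𝔭₁ = (136 + 458θ − 337δ)` and `≡ 3 (mod 𝔭'³)` at `𝔭' = (1 + 3θ + −δ)`, and `±ε` are non-squares (residue map at `5`).
THEN (★★★ `classGroupPRank_le_and_mu_lambda_cubicField_n12261`, UNCONDITIONAL) for `β` ANY root of the `2`-division cubic and EVERY cyclotomic `ℤ₂`-extension `κ` of `ℚ(β)`:
`rank₂ Cl(K_m) ≤ 1 ∀ m`, `μ₂(κ) = 0`, `λ₂(κ) ≤ 1` (`X` pro-cyclic); and (★) `MC₂(W)` modulo PRINT⁵ + MuIneqʳ + the crux's own hypotheses (att-p5 g24's carrier road).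
BSD is NOT proved; nothing is closed; C2's verdict is untouched.

References: [Washington1997] §13.1, §13.3 Lemmas 13.15, 13.18, Prop. 13.22–13.23; [Lang1990] Ch. 13 §4 Lemma 4.1; [Fukuda1994] Thm. 1; [Gras2003] IV.4;
[NeukirchANT1999] Ch. I §3, §8, Ch. III (1.6)–(1.7); [Omeara1963] §63B; [Cohen1993] §4.7, §6.5 (relation method, class group / units from the relation matrix);
[Marcus2018] Ch. 3 Thm. 27 and Ex. 21; [LMFDB] ec 12261, nf 3.1.4087.1; [Kato2004Asterisque] Thm. 17.4; [GreenbergLNM1716] Thm. 4.1; tree: att-p4 g46's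
`…CubicSplitStratumLayerTwoGeneralRelationDoor` and `…GeneralRelationRowN10913` (template), `Literature/…/ClassicalMuVanishesLayerTwoGeneralRelationCertificateTwoSplit`,
this seat's `CubicFieldDiscriminant4087{,Primes,ClassNumber}`, `…CubicSplitStratumSeedN12261`; att-p5 g24 `…CubicCarrierRoad`.
-/

set_option linter.dupNamespace false
set_option autoImplicit false

noncomputable section

open scoped Classical NumberField nonZeroDivisors IntermediateField

namespace Summit.BirchSwinnertonDyer.BirchSwinnertonDyer.Theorems.AlignedTransportAtTwoCubicSplitStratumLayerTwoGeneralRelationRowN12261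

open NumberField IsDedekindDomain Polynomial WeierstrassCurve IntermediateField CongruenceSubgroup Module
  Literature.NumberTheory.IwasawaTheory Literature.NumberTheory.GaloisRepresentations
  Literature.NumberTheory.EllipticCurves Literature.NumberTheory.EllipticCurves.Greenberg1999
  Literature.NumberTheory.EllipticCurves.ModularForms Literature.NumberTheory.EllipticCurves.Rank1Residual
  Literature.NumberTheory.EllipticCurves.Module
  Literature.NumberTheory.NumberFields Literature.NumberTheory.CubicFields
  Summit.BirchSwinnertonDyer.Rank1Residual Summit.BirchSwinnertonDyer.Rank1Residual.X1.MuLambda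
  Summit.BirchSwinnertonDyer.Rank1Residual.X5 Summit.BirchSwinnertonDyer.Rank1Residual.X5.O1
  Summit.BirchSwinnertonDyer.Rank1Residual.X5.Instances Summit.BirchSwinnertonDyer.Rank1Residual.F1Sign2
  Summit.BirchSwinnertonDyer.BirchSwinnertonDyer.Theorems.Rank1ResidualX1Defs
  Summit.BirchSwinnertonDyer.BirchSwinnertonDyer.Theorems.AlignedTransportAtTwoCubicCarrierRoad
  Summit.BirchSwinnertonDyer.BirchSwinnertonDyer.Theorems.AlignedTransportAtTwoCubicSplitStratumSeedN12261
  Summit.BirchSwinnertonDyer.BirchSwinnertonDyer.Theorems.AlignedTransportAtTwoCubicSplitStratumLayerTwoGeneralRelationDoor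

/-! ## §1 Residue maps of `𝓞_{ℚ(β)} = ℤ ⊕ ℤθ ⊕ ℤδ` (through `θ`, every odd `p`), the dyadic primes `𝔭₁ = (136 + 458 * θ - 337 * δ)`, `𝔭' = (1 + 3 * θ - δ)`, maximality of `(q₀)` -/

/-- `ψ_17 : 𝓞_{ℚ(β)} → ℤ/17` with `ψ(θ) = 14` (hence `ψ(δ) = 3`) — the degree-one prime `(17, θ − 14) = (q₀)`. [cite: Marcus2018, Ch. 3, Thm. 27] -/
theorem exists_residueHom_q {β : AlgebraicClosure ℚ} (hβ : aeval β ((⟨1, 1, 0, -430, -15761⟩ : WeierstrassCurve ℤ).baseChange ℚ).twoTorsionPolynomial.toPoly = 0) :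
    ∃ ψ : 𝓞 ↥(IntermediateField.adjoin ℚ ({β} : Set (AlgebraicClosure ℚ))) →+* ZMod 17, ψ (MonicCubic.thetaInt (aeval_theta_n12261 hβ)) = ((14 : ℤ) : ZMod 17) :=
  haveI : FiniteDimensional ℚ ↥(IntermediateField.adjoin ℚ ({β} : Set (AlgebraicClosure ℚ))) := IntermediateField.adjoin.finiteDimensional ((AlgebraicClosure.isAlgebraic ℚ).isAlgebraic β).isIntegral
  haveI : NumberField ↥(IntermediateField.adjoin ℚ ({β} : Set (AlgebraicClosure ℚ))) := NumberField.mk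
  haveI : Fact (Nat.Prime 17) := ⟨by norm_num⟩
  MonicCubic.exists_residueHom CubicDisc4087.irreducible_polyQ (aeval_theta_n12261 hβ) (finrank_cubicField_n12261 hβ)
    (CubicDisc4087.mem2 (finrank_cubicField_n12261 hβ) (aeval_theta_n12261 hβ)) (by norm_num) ((14) : ℤ) (by decide)

/-- `χ_5 : 𝓞_{ℚ(β)} → ℤ/5` with `χ(θ) = 1` (hence `χ(δ) = 1`); `±ε` are non-squares there (`χ(ε) = 2`, `5 ≡ 1 (mod 4)`). [cite: Marcus2018, Ch. 3, Thm. 27] -/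
theorem exists_residueHom_chi {β : AlgebraicClosure ℚ} (hβ : aeval β ((⟨1, 1, 0, -430, -15761⟩ : WeierstrassCurve ℤ).baseChange ℚ).twoTorsionPolynomial.toPoly = 0) :
    ∃ ψ : 𝓞 ↥(IntermediateField.adjoin ℚ ({β} : Set (AlgebraicClosure ℚ))) →+* ZMod 5, ψ (MonicCubic.thetaInt (aeval_theta_n12261 hβ)) = ((1 : ℤ) : ZMod 5) :=
  haveI : FiniteDimensional ℚ ↥(IntermediateField.adjoin ℚ ({β} : Set (AlgebraicClosure ℚ))) := IntermediateField.adjoin.finiteDimensional ((AlgebraicClosure.isAlgebraic ℚ).isAlgebraic β).isIntegral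
  haveI : NumberField ↥(IntermediateField.adjoin ℚ ({β} : Set (AlgebraicClosure ℚ))) := NumberField.mk
  haveI : Fact (Nat.Prime 5) := ⟨by norm_num⟩
  MonicCubic.exists_residueHom CubicDisc4087.irreducible_polyQ (aeval_theta_n12261 hβ) (finrank_cubicField_n12261 hβ)
    (CubicDisc4087.mem2 (finrank_cubicField_n12261 hβ) (aeval_theta_n12261 hβ)) (by norm_num) ((1) : ℤ) (by decide)

/-- **`N(𝔭₁) = 2`** for `𝔭₁ = (136 + 458 * θ - 337 * δ)` (the bit-`0` dyadic prime: every unit is `≡ ±1 (mod 𝔭₁³)`). [cite: Marcus2018, Ch. 3, Thm. 27 and Exercise 21] -/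
theorem absNorm_span_pi1_n12261 {β : AlgebraicClosure ℚ} (hβ : aeval β ((⟨1, 1, 0, -430, -15761⟩ : WeierstrassCurve ℤ).baseChange ℚ).twoTorsionPolynomial.toPoly = 0) :
    haveI : FiniteDimensional ℚ ↥(IntermediateField.adjoin ℚ ({β} : Set (AlgebraicClosure ℚ))) := IntermediateField.adjoin.finiteDimensional ((AlgebraicClosure.isAlgebraic ℚ).isAlgebraic β).isIntegral
    haveI : NumberField ↥(IntermediateField.adjoin ℚ ({β} : Set (AlgebraicClosure ℚ))) := NumberField.mk
    Ideal.absNorm (Ideal.span {((136 : 𝓞 ↥(IntermediateField.adjoin ℚ ({β} : Set (AlgebraicClosure ℚ)))) + (458 : 𝓞 ↥(IntermediateField.adjoin ℚ ({β} : Set (AlgebraicClosure ℚ)))) * MonicCubic.thetaInt (aeval_theta_n12261 hβ) + (-337 : 𝓞 ↥(IntermediateField.adjoin ℚ ({β} : Set (AlgebraicClosure ℚ)))) * MonicCubic.thetaInt (CubicDisc4087.delta_root (aeval_theta_n12261 hβ)))}) = 2 := by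
  haveI : FiniteDimensional ℚ ↥(IntermediateField.adjoin ℚ ({β} : Set (AlgebraicClosure ℚ))) := IntermediateField.adjoin.finiteDimensional ((AlgebraicClosure.isAlgebraic ℚ).isAlgebraic β).isIntegral
  haveI : NumberField ↥(IntermediateField.adjoin ℚ ({β} : Set (AlgebraicClosure ℚ))) := NumberField.mk
  rw [show (((136 : 𝓞 ↥(IntermediateField.adjoin ℚ ({β} : Set (AlgebraicClosure ℚ)))) + (458 : 𝓞 ↥(IntermediateField.adjoin ℚ ({β} : Set (AlgebraicClosure ℚ)))) * MonicCubic.thetaInt (aeval_theta_n12261 hβ) + (-337 : 𝓞 ↥(IntermediateField.adjoin ℚ ({β} : Set (AlgebraicClosure ℚ)))) * MonicCubic.thetaInt (CubicDisc4087.delta_root (aeval_theta_n12261 hβ))) : 𝓞 ↥(IntermediateField.adjoin ℚ ({β} : Set (AlgebraicClosure ℚ)))) = (136 + 458 * MonicCubic.thetaInt (aeval_theta_n12261 hβ) - 337 * MonicCubic.thetaInt (CubicDisc4087.delta_root (aeval_theta_n12261 hβ)) : 𝓞 ↥(IntermediateField.adjoin ℚ ({β} : Set (AlgebraicClosure ℚ))))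 by ring, Ideal.absNorm_span_singleton]
  exact CubicDisc4087.natAbs_norm_piC (finrank_cubicField_n12261 hβ) (aeval_theta_n12261 hβ)

/-- **`N(𝔭') = 2`** for `𝔭' = (1 + 3 * θ - δ)` (a bit-`1` dyadic prime: the unit `ε` is `≡ ±3 (mod 𝔭'³)`, not a norm from `ℚ(β,√2)`). [cite: Marcus2018, Ch. 3, Thm. 27 and Exercise 21] -/
theorem absNorm_span_pip_n12261 {β : AlgebraicClosure ℚ} (hβ : aeval β ((⟨1, 1, 0, -430, -15761⟩ : WeierstrassCurve ℤ).baseChange ℚ).twoTorsionPolynomial.toPoly = 0) :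
    haveI : FiniteDimensional ℚ ↥(IntermediateField.adjoin ℚ ({β} : Set (AlgebraicClosure ℚ))) := IntermediateField.adjoin.finiteDimensional ((AlgebraicClosure.isAlgebraic ℚ).isAlgebraic β).isIntegral
    haveI : NumberField ↥(IntermediateField.adjoin ℚ ({β} : Set (AlgebraicClosure ℚ))) := NumberField.mk
    Ideal.absNorm (Ideal.span {((1 : 𝓞 ↥(IntermediateField.adjoin ℚ ({β} : Set (AlgebraicClosure ℚ)))) + (3 : 𝓞 ↥(IntermediateField.adjoin ℚ ({β} : Set (AlgebraicClosure ℚ)))) * MonicCubic.thetaInt (aeval_theta_n12261 hβ) + (-1 : 𝓞 ↥(IntermediateField.adjoin ℚ ({β} : Set (AlgebraicClosure ℚ)))) * MonicCubic.thetaInt (CubicDisc4087.delta_root (aeval_theta_n12261 hβ)))}) = 2 := by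
  haveI : FiniteDimensional ℚ ↥(IntermediateField.adjoin ℚ ({β} : Set (AlgebraicClosure ℚ))) := IntermediateField.adjoin.finiteDimensional ((AlgebraicClosure.isAlgebraic ℚ).isAlgebraic β).isIntegral
  haveI : NumberField ↥(IntermediateField.adjoin ℚ ({β} : Set (AlgebraicClosure ℚ))) := NumberField.mk
  rw [show (((1 : 𝓞 ↥(IntermediateField.adjoin ℚ ({β} : Set (AlgebraicClosure ℚ)))) + (3 : 𝓞 ↥(IntermediateField.adjoin ℚ ({β} : Set (AlgebraicClosure ℚ)))) * MonicCubic.thetaInt (aeval_theta_n12261 hβ) + (-1 : 𝓞 ↥(IntermediateField.adjoin ℚ ({β} : Set (AlgebraicClosure ℚ)))) * MonicCubic.thetaInt (CubicDisc4087.delta_root (aeval_theta_n12261 hβ))) : 𝓞 ↥(IntermediateField.adjoin ℚ ({β} : Set (AlgebraicClosure ℚ)))) = (1 + 3 * MonicCubic.thetaInt (aeval_theta_n12261 hβ) - MonicCubic.thetaInt (CubicDisc4087.delta_root (aeval_theta_n12261 hβ)) : 𝓞 ↥(IntermediateField.adjoin ℚ ({β} : Set (AlgebraicClosure ℚ))))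 by ring, Ideal.absNorm_span_singleton]
  exact CubicDisc4087.natAbs_norm_piA (finrank_cubicField_n12261 hβ) (aeval_theta_n12261 hβ)

/-- **`(q₀) = (17, θ − 14)` is maximal** (kernel of `ψ_17`; `17 = q₀·q₀'`, `θ − 14 = q₀·w`, `q₀ ∈ (17, θ − 14)` with explicit witnesses on `1, θ, δ`).
[cite: Marcus2018, Ch. 3, Thm. 27] -/
theorem isMaximal_span_q0_n12261 {β : AlgebraicClosure ℚ} (hβ : aeval β ((⟨1, 1, 0, -430, -15761⟩ : WeierstrassCurve ℤ).baseChange ℚ).twoTorsionPolynomial.toPoly = 0) :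
    haveI : FiniteDimensional ℚ ↥(IntermediateField.adjoin ℚ ({β} : Set (AlgebraicClosure ℚ))) := IntermediateField.adjoin.finiteDimensional ((AlgebraicClosure.isAlgebraic ℚ).isAlgebraic β).isIntegral
    haveI : NumberField ↥(IntermediateField.adjoin ℚ ({β} : Set (AlgebraicClosure ℚ))) := NumberField.mk
    (Ideal.span {((-4667 : 𝓞 ↥(IntermediateField.adjoin ℚ ({β} : Set (AlgebraicClosure ℚ)))) + (1878 : 𝓞 ↥(IntermediateField.adjoin ℚ ({β} : Set (AlgebraicClosure ℚ)))) * MonicCubic.thetaInt (aeval_theta_n12261 hβ) + (-448 : 𝓞 ↥(IntermediateField.adjoin ℚ ({β} : Set (AlgebraicClosure ℚ)))) * MonicCubic.thetaInt (CubicDisc4087.delta_root (aeval_theta_n12261 hβ)))}).IsMaximal := by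
  haveI : FiniteDimensional ℚ ↥(IntermediateField.adjoin ℚ ({β} : Set (AlgebraicClosure ℚ))) := IntermediateField.adjoin.finiteDimensional ((AlgebraicClosure.isAlgebraic ℚ).isAlgebraic β).isIntegral
  haveI : NumberField ↥(IntermediateField.adjoin ℚ ({β} : Set (AlgebraicClosure ℚ))) := NumberField.mk
  haveI : Fact (Nat.Prime 17) := ⟨by norm_num⟩
  have hθ := aeval_theta_n12261 hβ
  have h3 := finrank_cubicField_n12261 hβ
  obtain ⟨ψ, hψ⟩ := exists_residueHom_q hβ
  set θI : 𝓞 ↥(IntermediateField.adjoin ℚ ({β} : Set (AlgebraicClosure ℚ))) := MonicCubic.thetaInt hθ with hθI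
  set δI : 𝓞 ↥(IntermediateField.adjoin ℚ ({β} : Set (AlgebraicClosure ℚ))) := MonicCubic.thetaInt (CubicDisc4087.delta_root hθ) with hδI
  obtain ⟨hX2, hXY, hY2⟩ := CubicDisc4087.mul_table hθ
  rw [← hθI, ← hδI] at hX2 hXY hY2
  have hexp : ¬ 17 ∣ RingOfIntegers.exponent (MonicCubic.thetaInt hθ) := CubicDisc4087.not_dvd_exponent h3 hθ (by norm_num) (by norm_num)
  have hker := MonicCubic.ker_residueHom_eq_span CubicDisc4087.irreducible_polyQ hθ hexp ψ hψ
  have hspan : Ideal.span {((17 : ℕ) : 𝓞 ↥(IntermediateField.adjoin ℚ ({β} : Set (AlgebraicClosure ℚ)))), MonicCubic.thetaInt hθ - ((14 : ℤ) : 𝓞 ↥(IntermediateField.adjoin ℚ ({β} : Set (AlgebraicClosure ℚ))))} = Ideal.span {((-4667 : 𝓞 ↥(IntermediateField.adjoin ℚ ({β} : Set (AlgebraicClosure ℚ)))) + (1878 : 𝓞 ↥(IntermediateField.adjoin ℚ ({β} : Set (AlgebraicClosure ℚ)))) * θI + (-448 : 𝓞 ↥(IntermediateField.adjoin ℚ ({β}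 : Set (AlgebraicClosure ℚ)))) * δI)} := by
    rw [← hθI]
    apply le_antisymm
    · rw [Ideal.span_le]
      intro x hx
      simp only [Set.mem_insert_iff, Set.mem_singleton_iff] at hx
      rcases hx with rfl | rfl
      · exact Ideal.mem_span_singleton'.mpr ⟨((29 : 𝓞 ↥(IntermediateField.adjoin ℚ ({β} : Set (AlgebraicClosure ℚ)))) + (78 : 𝓞 ↥(IntermediateField.adjoin ℚ ({β} : Set (AlgebraicClosure ℚ)))) * θI + (-8 : 𝓞 ↥(IntermediateField.adjoin ℚ ({β} : Set (AlgebraicClosure ℚ)))) * δI), by push_cast; linear_combination ((146484 : 𝓞 ↥(IntermediateField.adjoin ℚ ({β} : Set (AlgebraicClosure ℚ))))) * hX2 + ((-49968 : 𝓞 ↥(IntermediateField.adjoin ℚ ({β} : Set (AlgebraicClosure ℚ))))) * hXY + ((3584 : 𝓞 ↥(IntermediateField.adjoin ℚ ({β} : Set (AlgebraicClosure ℚ))))) * hY2⟩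
      · exact Ideal.mem_span_singleton'.mpr ⟨((-22 : 𝓞 ↥(IntermediateField.adjoin ℚ ({β} : Set (AlgebraicClosure ℚ)))) + (-61 : 𝓞 ↥(IntermediateField.adjoin ℚ ({β} : Set (AlgebraicClosure ℚ)))) * θI + (12 : 𝓞 ↥(IntermediateField.adjoin ℚ ({β} : Set (AlgebraicClosure ℚ)))) * δI), by push_cast; linear_combination ((-114558 : 𝓞 ↥(IntermediateField.adjoin ℚ ({β} : Set (AlgebraicClosure ℚ))))) * hX2 + ((49864 : 𝓞 ↥(IntermediateField.adjoin ℚ ({β} : Set (AlgebraicClosure ℚ))))) * hXY + ((-5376 : 𝓞 ↥(IntermediateField.adjoin ℚ ({β} : Set (AlgebraicClosure ℚ))))) * hY2⟩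
    · rw [Ideal.span_singleton_le_iff_mem, Ideal.mem_span_pair]
      exact ⟨((-165 : 𝓞 ↥(IntermediateField.adjoin ℚ ({β} : Set (AlgebraicClosure ℚ)))) + (55 : 𝓞 ↥(IntermediateField.adjoin ℚ ({β} : Set (AlgebraicClosure ℚ)))) * θI + (-20 : 𝓞 ↥(IntermediateField.adjoin ℚ ({β} : Set (AlgebraicClosure ℚ)))) * δI), ((133 : 𝓞 ↥(IntermediateField.adjoin ℚ ({β} : Set (AlgebraicClosure ℚ)))) + (-54 : 𝓞 ↥(IntermediateField.adjoin ℚ ({β} : Set (AlgebraicClosure ℚ)))) * θI + (0 : 𝓞 ↥(IntermediateField.adjoin ℚ ({β} : Set (AlgebraicClosure ℚ)))) * δI), by push_cast; linear_combination ((-54 : 𝓞 ↥(IntermediateField.adjoin ℚ ({β} : Set (AlgebraicClosure ℚ))))) * hX2 + ((0 : 𝓞 ↥(IntermediateField.adjoin ℚ ({β} : Set (AlgebraicClosure ℚ))))) * hXY + ((0 : 𝓞 ↥(IntermediateField.adjoin ℚ ({β} : Set (AlgebraicClosure ℚ))))) * hY2⟩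
  rw [← hspan, ← hker]
  exact ker_zmod_isMaximal ψ

/-! ## §2 The power-membership certificates `y ∈ σ^i(𝔮)^{eᵢ}` (two-term form `y = λ·q₀^{eᵢ} + μ·(σ^i s₂ − t)^{eᵢ}`; the trivial ones, `eᵢ = 0`, are inlined in §3) -/

/-- Membership certificate `y ∈ σ^0(𝔮)^3` (`𝔮 = (q₀, s₂ − 5)`): `y = λ·q₀^3 + μ·(σ^0s₂ − 5)^3` in `𝓞_K[s₁,s₂]` (`(q₀^3, (σ^0s₂ − 5)^3) = σ^0(𝔮)^3`; `λ, μ` by lattice reduction on the seat), valid in every commutative ring with the tower relations and the multiplication table of `CubicDisc4087`. [cite: Cohen1993, §4.7] [cite: NeukirchANT1999, Ch. I §3 (3.3)] -/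
theorem mem_sigma0_n12261 {β : AlgebraicClosure ℚ} (hβ : aeval β ((⟨1, 1, 0, -430, -15761⟩ : WeierstrassCurve ℤ).baseChange ℚ).twoTorsionPolynomial.toPoly = 0) :
    haveI : FiniteDimensional ℚ ↥(IntermediateField.adjoin ℚ ({β} : Set (AlgebraicClosure ℚ))) := IntermediateField.adjoin.finiteDimensional ((AlgebraicClosure.isAlgebraic ℚ).isAlgebraic β).isIntegral
    haveI : NumberField ↥(IntermediateField.adjoin ℚ ({β} : Set (AlgebraicClosure ℚ))) := NumberField.mk
    ∀ (R : Type) [CommRing R] (φ : 𝓞 ↥(IntermediateField.adjoin ℚ ({β} : Set (AlgebraicClosure ℚ))) →+* R) (S₁ S₂ : R), S₁ ^ 2 = 2 → S₂ ^ 2 = 2 + S₁ →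
      ∃ c : ℕ → R, φ ((308215 : 𝓞 ↥(IntermediateField.adjoin ℚ ({β} : Set (AlgebraicClosure ℚ)))) + (-124024 : 𝓞 ↥(IntermediateField.adjoin ℚ ({β} : Set (AlgebraicClosure ℚ)))) * MonicCubic.thetaInt (aeval_theta_n12261 hβ) + (29586 : 𝓞 ↥(IntermediateField.adjoin ℚ ({β} : Set (AlgebraicClosure ℚ)))) * MonicCubic.thetaInt (CubicDisc4087.delta_root (aeval_theta_n12261 hβ))) + φ ((358730 : 𝓞 ↥(IntermediateField.adjoin ℚ ({β} : Set (AlgebraicClosure ℚ)))) + (-144351 : 𝓞 ↥(IntermediateField.adjoin ℚ ({β} : Set (AlgebraicClosure ℚ)))) * MonicCubic.thetaInt (aeval_theta_n12261 hβ) + (34435 : 𝓞 ↥(IntermediateField.adjoin ℚ ({β} : Set (AlgebraicClosure ℚ)))) * MonicCubic.thetaInt (CubicDisc4087.delta_root (aeval_theta_n12261 hβ))) * S₁ + (φ ((90508 : 𝓞 ↥(IntermediateField.adjoin ℚ ({β} : Set (AlgebraicClosure ℚ)))) + (-36420 : 𝓞 ↥(IntermediateField.adjoin ℚ ({β} : Set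 (AlgebraicClosure ℚ)))) * MonicCubic.thetaInt (aeval_theta_n12261 hβ) + (8688 : 𝓞 ↥(IntermediateField.adjoin ℚ ({β} : Set (AlgebraicClosure ℚ)))) * MonicCubic.thetaInt (CubicDisc4087.delta_root (aeval_theta_n12261 hβ))) + φ ((248095 : 𝓞 ↥(IntermediateField.adjoin ℚ ({β} : Set (AlgebraicClosure ℚ)))) + (-99832 : 𝓞 ↥(IntermediateField.adjoin ℚ ({β} : Set (AlgebraicClosure ℚ)))) * MonicCubic.thetaInt (aeval_theta_n12261 hβ) + (23815 : 𝓞 ↥(IntermediateField.adjoin ℚ ({β} : Set (AlgebraicClosure ℚ)))) * MonicCubic.thetaInt (CubicDisc4087.delta_root (aeval_theta_n12261 hβ))) * S₁) * S₂ =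
        ∑ k ∈ Finset.range (3 + 1), c k * φ ((-4667 : 𝓞 ↥(IntermediateField.adjoin ℚ ({β} : Set (AlgebraicClosure ℚ)))) + (1878 : 𝓞 ↥(IntermediateField.adjoin ℚ ({β} : Set (AlgebraicClosure ℚ)))) * MonicCubic.thetaInt (aeval_theta_n12261 hβ) + (-448 : 𝓞 ↥(IntermediateField.adjoin ℚ ({β} : Set (AlgebraicClosure ℚ)))) * MonicCubic.thetaInt (CubicDisc4087.delta_root (aeval_theta_n12261 hβ))) ^ (3 - k) * (S₂ - ((5 : ℤ) : R)) ^ k := by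
  haveI : FiniteDimensional ℚ ↥(IntermediateField.adjoin ℚ ({β} : Set (AlgebraicClosure ℚ))) := IntermediateField.adjoin.finiteDimensional ((AlgebraicClosure.isAlgebraic ℚ).isAlgebraic β).isIntegral
  haveI : NumberField ↥(IntermediateField.adjoin ℚ ({β} : Set (AlgebraicClosure ℚ))) := NumberField.mk
  intro R _ φ S₁ S₂ hS₁ hS₂
  have hθ := aeval_theta_n12261 hβ
  set θI : 𝓞 ↥(IntermediateField.adjoin ℚ ({β} : Set (AlgebraicClosure ℚ))) := MonicCubic.thetaInt hθ with hθI
  set δI : 𝓞 ↥(IntermediateField.adjoin ℚ ({β} : Set (AlgebraicClosure ℚ))) := MonicCubic.thetaInt (CubicDisc4087.delta_root hθ) with hδI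
  obtain ⟨hX2, hXY, hY2⟩ := CubicDisc4087.mul_table hθ
  rw [← hθI, ← hδI] at hX2 hXY hY2
  have hX2' := congrArg φ hX2
  have hXY' := congrArg φ hXY
  have hY2' := congrArg φ hY2
  simp only [map_add, map_mul, map_pow, map_sub, map_neg, map_ofNat] at hX2' hXY' hY2'
  refine ⟨fun k => (((1 - k : ℕ) : R)) * ((22047 + 53966 * φ θI + 11211 * φ δI) + (7233 + 18326 * φ θI + 1661 * φ δI) * S₁ + (((-20160) + (-58061) * φ θI + 18039 * φ δI) + ((-4796) + (-17593) * φ θI + 16565 * φ δI) * S₁) * S₂) + (((k - 2 : ℕ) : R)) * (((-18990) + 7642 * φ θI + (-1823) * φ δI) + ((-2385) + 960 * φ θI + (-229) * φ δI) * S₁ + (((-46608) + 18755 * φ θI + (-4474) * φ δI) + ((-15626) + 6288 * φ θI + (-1500) * φ δI) * S₁) * S₂), ?_⟩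
  simp only [Finset.sum_range_succ, Finset.sum_range_zero, zero_add, map_add, map_mul, map_neg, map_ofNat]
  linear_combination (1245287 + (-232005) * S₂ + 15626 * S₁ + 119539 * φ δI + (-22271) * S₂ * φ δI + 1500 * S₁ * φ δI + (-501107) * φ θI + 93360 * S₂ * φ θI + (-6288) * S₁ * φ θI) * hS₁ + (3303966 + (-680130) * S₂ + 46608 * S₂ ^ 2 + 1214035 * S₁ + (-232005) * S₁ * S₂ + 15626 * S₁ * S₂ ^ 2 + 15626 * S₁ ^ 2 + 317153 * φ δI + (-65287) * S₂ * φ δI + 4474 * S₂ ^ 2 * φ δI + 116539 * S₁ * φ δI + (-22271) * S₁ * S₂ * φ δI + 1500 * S₁ * S₂ ^ 2 * φ δI + 1500 * S₁ ^ 2 * φ δI + (-1329505) * φ θI + 273683 * S₂ * φ θI + (-18755) * S₂ ^ 2 * φ θI + (-488531) * S₁ * φ θI + 93360 * S₁ * S₂ * φ θI + (-6288) * S₁ * S₂ ^ 2 * φ θI + (-6288) * S₁ ^ 2 * φ θI) * hS₂ + ((-8409930524308800) + 9247454709209622 * S₂ + (-2870093742362424) * S₁ + 2875574504204910 * S₁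 * S₂ + (-1509734559141900) * φ δI + 3326910978755412 * S₂ * φ δI + (-634072741549524) * S₁ * φ δI + 1635888720366108 * S₁ * S₂ * φ δI + (-7881315160320) * φ δI ^ 2 + 151160667114240 * S₂ * φ δI ^ 2 + (-12849064462080) * S₁ * φ δI ^ 2 + 98413860319488 * S₁ * S₂ * φ δI ^ 2 + 2876250957361632 * φ θI + (-3118083365796876) * S₂ * φ θI + 978410454322320 * S₁ * φ θI + (-953501409319356) * S₁ * S₂ * φ θI + 181550043020664 * φ θI * φ δI + (-394697912399784) * S₂ * φ θI * φ δI + 75866046970824 * S₁ * φ θI * φ δI + (-193111225202808) * S₁ * S₂ * φ θI * φ δI + (-357443161610832) * φ θI ^ 2 + 384566345593272 * S₂ * φ θI ^ 2 + (-121382043873552) * S₁ * φ θI ^ 2 + 116527027058136 * S₁ * S₂ * φ θI ^ 2) * hX2' + (4466859430637942 + (-6527655192952538) * S₂ + 1639636567563194 * S₁ + (-2612833177555198) * S₁ * S₂ + 280861615615216 * φ δI + (-1260448415737168) * S₂ * φ δI + 163697906120080 * S₁ * φ δI + (-735271412060912) * S₁ * S₂ * φ δI + (-7824647348224) * φ δI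 ^ 2 + (-25618471510016) * S₂ * φ δI ^ 2 + (-230413410304) * S₁ * φ δI ^ 2 + (-20313025847296) * S₁ * S₂ * φ δI ^ 2) * hXY' + ((-868129394561752) + 1336740464498920 * S₂ + (-323516756855528) * S₁ + 553545141675768 * S₁ * S₂ + (-21688945177088) * φ δI + 183557107123712 * S₂ * φ δI + (-18788536270336) * S₁ * φ δI + 114698183717376 * S₁ * S₂ * φ δI + 1008041459712 * φ δI ^ 2 + 1621983756288 * S₂ * φ δI ^ 2 + 149349466112 * S₁ * φ δI ^ 2 + 1489448468480 * S₁ * S₂ * φ δI ^ 2) * hY2'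

/-- Membership certificate `y ∈ σ^1(𝔮)^1` (`𝔮 = (q₀, s₂ − 5)`): `y = λ·q₀^1 + μ·(σ^1s₂ − 5)^1` in `𝓞_K[s₁,s₂]` (`(q₀^1, (σ^1s₂ − 5)^1) = σ^1(𝔮)^1`; `λ, μ` by lattice reduction on the seat), valid in every commutative ring with the tower relations and the multiplication table of `CubicDisc4087`. [cite: Cohen1993, §4.7] [cite: NeukirchANT1999, Ch. I §3 (3.3)] -/
theorem mem_sigma1_n12261 {β : AlgebraicClosure ℚ} (hβ : aeval β ((⟨1, 1, 0, -430, -15761⟩ : WeierstrassCurve ℤ).baseChange ℚ).twoTorsionPolynomial.toPoly = 0) :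
    haveI : FiniteDimensional ℚ ↥(IntermediateField.adjoin ℚ ({β} : Set (AlgebraicClosure ℚ))) := IntermediateField.adjoin.finiteDimensional ((AlgebraicClosure.isAlgebraic ℚ).isAlgebraic β).isIntegral
    haveI : NumberField ↥(IntermediateField.adjoin ℚ ({β} : Set (AlgebraicClosure ℚ))) := NumberField.mk
    ∀ (R : Type) [CommRing R] (φ : 𝓞 ↥(IntermediateField.adjoin ℚ ({β} : Set (AlgebraicClosure ℚ))) →+* R) (S₁ S₂ : R), S₁ ^ 2 = 2 → S₂ ^ 2 = 2 + S₁ →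
      ∃ c : ℕ → R, φ ((308215 : 𝓞 ↥(IntermediateField.adjoin ℚ ({β} : Set (AlgebraicClosure ℚ)))) + (-124024 : 𝓞 ↥(IntermediateField.adjoin ℚ ({β} : Set (AlgebraicClosure ℚ)))) * MonicCubic.thetaInt (aeval_theta_n12261 hβ) + (29586 : 𝓞 ↥(IntermediateField.adjoin ℚ ({β} : Set (AlgebraicClosure ℚ)))) * MonicCubic.thetaInt (CubicDisc4087.delta_root (aeval_theta_n12261 hβ))) + φ ((358730 : 𝓞 ↥(IntermediateField.adjoin ℚ ({β} : Set (AlgebraicClosure ℚ)))) + (-144351 : 𝓞 ↥(IntermediateField.adjoin ℚ ({β} : Set (AlgebraicClosure ℚ)))) * MonicCubic.thetaInt (aeval_theta_n12261 hβ) + (34435 : 𝓞 ↥(IntermediateField.adjoin ℚ ({β} : Set (AlgebraicClosure ℚ)))) * MonicCubic.thetaInt (CubicDisc4087.delta_root (aeval_theta_n12261 hβ))) * S₁ + (φ ((90508 : 𝓞 ↥(IntermediateField.adjoin ℚ ({β} : Set (AlgebraicClosure ℚ)))) + (-36420 : 𝓞 ↥(IntermediateField.adjoin ℚ ({β} : Set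 (AlgebraicClosure ℚ)))) * MonicCubic.thetaInt (aeval_theta_n12261 hβ) + (8688 : 𝓞 ↥(IntermediateField.adjoin ℚ ({β} : Set (AlgebraicClosure ℚ)))) * MonicCubic.thetaInt (CubicDisc4087.delta_root (aeval_theta_n12261 hβ))) + φ ((248095 : 𝓞 ↥(IntermediateField.adjoin ℚ ({β} : Set (AlgebraicClosure ℚ)))) + (-99832 : 𝓞 ↥(IntermediateField.adjoin ℚ ({β} : Set (AlgebraicClosure ℚ)))) * MonicCubic.thetaInt (aeval_theta_n12261 hβ) + (23815 : 𝓞 ↥(IntermediateField.adjoin ℚ ({β} : Set (AlgebraicClosure ℚ)))) * MonicCubic.thetaInt (CubicDisc4087.delta_root (aeval_theta_n12261 hβ))) * S₁) * S₂ =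
        ∑ k ∈ Finset.range (1 + 1), c k * φ ((-4667 : 𝓞 ↥(IntermediateField.adjoin ℚ ({β} : Set (AlgebraicClosure ℚ)))) + (1878 : 𝓞 ↥(IntermediateField.adjoin ℚ ({β} : Set (AlgebraicClosure ℚ)))) * MonicCubic.thetaInt (aeval_theta_n12261 hβ) + (-448 : 𝓞 ↥(IntermediateField.adjoin ℚ ({β} : Set (AlgebraicClosure ℚ)))) * MonicCubic.thetaInt (CubicDisc4087.delta_root (aeval_theta_n12261 hβ))) ^ (1 - k) * (S₁ * S₂ - S₂ - ((5 : ℤ) : R)) ^ k := by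
  haveI : FiniteDimensional ℚ ↥(IntermediateField.adjoin ℚ ({β} : Set (AlgebraicClosure ℚ))) := IntermediateField.adjoin.finiteDimensional ((AlgebraicClosure.isAlgebraic ℚ).isAlgebraic β).isIntegral
  haveI : NumberField ↥(IntermediateField.adjoin ℚ ({β} : Set (AlgebraicClosure ℚ))) := NumberField.mk
  intro R _ φ S₁ S₂ hS₁ hS₂
  have hθ := aeval_theta_n12261 hβ
  set θI : 𝓞 ↥(IntermediateField.adjoin ℚ ({β} : Set (AlgebraicClosure ℚ))) := MonicCubic.thetaInt hθ with hθI
  set δI : 𝓞 ↥(IntermediateField.adjoin ℚ ({β} : Set (AlgebraicClosure ℚ))) := MonicCubic.thetaInt (CubicDisc4087.delta_root hθ) with hδI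
  obtain ⟨hX2, hXY, hY2⟩ := CubicDisc4087.mul_table hθ
  rw [← hθI, ← hδI] at hX2 hXY hY2
  have hX2' := congrArg φ hX2
  have hXY' := congrArg φ hXY
  have hY2' := congrArg φ hY2
  simp only [map_add, map_mul, map_pow, map_sub, map_neg, map_ofNat] at hX2' hXY' hY2'
  refine ⟨fun k => (((1 - k : ℕ) : R)) * (((-51) + 33 * φ θI + 20 * φ δI) + ((-65) + 25 * φ θI + 19 * φ δI) * S₁ + (((-14) + 20 * φ θI + (-19) * φ δI) + ((-41) + 32 * φ θI + (-1) * φ δI) * S₁) * S₂) + ((k : ℕ) : R) * ((0 + 1 * φ θI + 0 * φ δI) + ((-11) + 5 * φ θI + (-1) * φ δI) * S₁ + ((32 + (-13) * φ θI + 3 * φ δI) + (11 + (-4) * φ θI + 1 * φ δI) * S₁) * S₂), ?_⟩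
  simp only [Finset.sum_range_succ, Finset.sum_range_zero, zero_add, Nat.cast_zero, Nat.cast_one, map_add, map_mul, map_neg, map_ofNat]
  linear_combination ((-43) + 11 * S₂ + (-11) * S₁ + (-4) * φ δI + 1 * S₂ * φ δI + (-1) * S₁ * φ δI + 17 * φ θI + (-5) * S₂ * φ θI + 4 * S₁ * φ θI) * hS₁ + (32 + (-21) * S₁ + (-11) * S₁ ^ 2 + 3 * φ δI + (-2) * S₁ * φ δI + (-1) * S₁ ^ 2 * φ δI + (-13) * φ θI + 9 * S₁ * φ θI + 4 * S₁ ^ 2 * φ θI) * hS₂ + ((-61974) + (-37560) * S₂ + (-46950) * S₁ + (-60096) * S₁ * S₂) * hX2' + ((-22776) + 44642 * S₂ + (-24482) * S₁ + 16214 * S₁ * S₂) * hXY' + (8960 + (-8512) * S₂ + 8512 * S₁ + (-448) * S₁ * S₂) * hY2'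

/-! ## §3 ★★★ The general relation row at layer two on the split stratum: `rank₂ ≤ 1`, `μ₂ = 0`, `λ₂ ≤ 1` — UNCONDITIONAL -/

set_option maxHeartbeats 4000000 in
/-- ★★★ **`rank₂ Cl(K_m) ≤ 1 ∀ m`, `μ₂ = 0`, `λ₂ ≤ 1` — UNCONDITIONAL — for every cyclotomic `ℤ₂`-extension of the cubic `2`-torsion field of `⟨1, 1, 0, -430, -15761⟩`**
(`N = 12261`, split stratum, cubic field `−4087`): the split-stratum GENERAL layer-two relation door in coordinates with the datum `q₀ = -4667 + 1878 * θ - 448 * δ` (norm `-17`), `t = 5`,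
exponents `e = (3, 1, 0, 0)` (`Σ eᵢXⁱ = (X−1)^1 + 2g`), `y` (blocks on `1, s₁, s₂, s₁s₂`), `N(y) = ε_y q₀^4`, memberships and coprimality witnesses; the unit
`ε = -1226625 - 3717338 * θ + 1697040 * δ` is `≡ ±1 (mod 𝔭₁³)` and `≡ ±3 (mod 𝔭'³)`.
[cite: Washington1997, §13.3 Lemmas 13.15, 13.18, Prop. 13.22–13.23] [cite: Lang1990, Ch. 13 §4 Lemma 4.1] [cite: Fukuda1994, Thm. 1, p. 264] [cite: Cohen1993, §6.5]
[cite: LMFDB, number field 3.1.4087.1] -/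
theorem classGroupPRank_le_and_mu_lambda_cubicField_n12261 {β : AlgebraicClosure ℚ} (hβ : aeval β ((⟨1, 1, 0, -430, -15761⟩ : WeierstrassCurve ℤ).baseChange ℚ).twoTorsionPolynomial.toPoly = 0)
    (κP : ZpExtension ↥(IntermediateField.adjoin ℚ ({β} : Set (AlgebraicClosure ℚ))) 2) (hκP : κP.IsCyclotomic) :
    (∀ m, classGroupPRank κP m ≤ 1) ∧ ClassicalMuVanishes κP ∧ classicalLambda κP ≤ 1 := by
  haveI := isElliptic_n12261
  haveI := isGloballyMinimal_n12261
  haveI : FiniteDimensional ℚ ↥(IntermediateField.adjoin ℚ ({β} : Set (AlgebraicClosure ℚ))) := IntermediateField.adjoin.finiteDimensional ((AlgebraicClosure.isAlgebraic ℚ).isAlgebraic β).isIntegral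
  haveI : NumberField ↥(IntermediateField.adjoin ℚ ({β} : Set (AlgebraicClosure ℚ))) := NumberField.mk
  have hord : IsOrdinaryAt ((⟨1, 1, 0, -430, -15761⟩ : WeierstrassCurve ℤ).baseChange ℚ) 2 := goodOrd_two_n12261
  have ht := not_hasRationalTwoTorsionX_n12261
  have hθ := aeval_theta_n12261 hβ
  have h3 := finrank_cubicField_n12261 hβ
  have hd : ¬ (2 : ℤ) ∣ NumberField.discr ↥(IntermediateField.adjoin ℚ ({β} : Set (AlgebraicClosure ℚ))) := by
    rw [CubicDisc4087.discr_eq h3 hθ]; norm_num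
  obtain ⟨ψ, hψ⟩ := exists_residueHom_q hβ
  obtain ⟨χ, hχ⟩ := exists_residueHom_chi hβ
  have hmax := isMaximal_span_q0_n12261 hβ
  have hN1 := absNorm_span_pi1_n12261 hβ
  have hN' := absNorm_span_pip_n12261 hβ
  set θI : 𝓞 ↥(IntermediateField.adjoin ℚ ({β} : Set (AlgebraicClosure ℚ))) := MonicCubic.thetaInt hθ with hθI
  set δI : 𝓞 ↥(IntermediateField.adjoin ℚ ({β} : Set (AlgebraicClosure ℚ))) := MonicCubic.thetaInt (CubicDisc4087.delta_root hθ) with hδI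
  obtain ⟨hX2, hXY, hY2⟩ := CubicDisc4087.mul_table hθ
  have hden := CubicDisc4087.den_delta hθ
  rw [← hθI, ← hδI] at hX2 hXY hY2 hden
  have hm0 := mem_sigma0_n12261 hβ
  have hm1 := mem_sigma1_n12261 hβ
  have hm2 : ∀ (R : Type) [CommRing R] (φ : 𝓞 ↥(IntermediateField.adjoin ℚ ({β} : Set (AlgebraicClosure ℚ))) →+* R) (S₁ S₂ : R), S₁ ^ 2 = 2 → S₂ ^ 2 = 2 + S₁ →
      ∃ c : ℕ → R, φ ((308215 : 𝓞 ↥(IntermediateField.adjoin ℚ ({β} : Set (AlgebraicClosure ℚ)))) + (-124024 : 𝓞 ↥(IntermediateField.adjoin ℚ ({β} : Set (AlgebraicClosure ℚ)))) * θI + (29586 : 𝓞 ↥(IntermediateField.adjoin ℚ ({β} : Set (AlgebraicClosure ℚ)))) * δI) + φ ((358730 : 𝓞 ↥(IntermediateField.adjoin ℚ ({β} : Set (AlgebraicClosure ℚ)))) + (-144351 : 𝓞 ↥(IntermediateField.adjoin ℚ ({β} : Set (AlgebraicClosure ℚ)))) * θI + (34435 : 𝓞 ↥(IntermediateField.adjoin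 ℚ ({β} : Set (AlgebraicClosure ℚ)))) * δI) * S₁ + (φ ((90508 : 𝓞 ↥(IntermediateField.adjoin ℚ ({β} : Set (AlgebraicClosure ℚ)))) + (-36420 : 𝓞 ↥(IntermediateField.adjoin ℚ ({β} : Set (AlgebraicClosure ℚ)))) * θI + (8688 : 𝓞 ↥(IntermediateField.adjoin ℚ ({β} : Set (AlgebraicClosure ℚ)))) * δI) + φ ((248095 : 𝓞 ↥(IntermediateField.adjoin ℚ ({β} : Set (AlgebraicClosure ℚ)))) + (-99832 : 𝓞 ↥(IntermediateField.adjoin ℚ ({β} : Set (AlgebraicClosure ℚ)))) * θI + (23815 : 𝓞 ↥(IntermediateField.adjoin ℚ ({β} : Set (AlgebraicClosure ℚ)))) * δI) * S₁) * S₂ = ∑ k ∈ Finset.range (0 + 1), c k * φ ((-4667 : 𝓞 ↥(IntermediateField.adjoin ℚ ({β} : Set (AlgebraicClosure ℚ)))) + (1878 : 𝓞 ↥(IntermediateField.adjoin ℚ ({β} : Set (AlgebraicClosure ℚ)))) * θI + (-448 : 𝓞 ↥(IntermediateField.adjoin ℚ ({β} : Set (AlgebraicClosure ℚ)))) * δI)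 ^ (0 - k) * (-S₂ - ((5 : ℤ) : R)) ^ k :=
    fun R _ φ S₁ S₂ _ _ => ⟨fun _ => φ ((308215 : 𝓞 ↥(IntermediateField.adjoin ℚ ({β} : Set (AlgebraicClosure ℚ)))) + (-124024 : 𝓞 ↥(IntermediateField.adjoin ℚ ({β} : Set (AlgebraicClosure ℚ)))) * θI + (29586 : 𝓞 ↥(IntermediateField.adjoin ℚ ({β} : Set (AlgebraicClosure ℚ)))) * δI) + φ ((358730 : 𝓞 ↥(IntermediateField.adjoin ℚ ({β} : Set (AlgebraicClosure ℚ)))) + (-144351 : 𝓞 ↥(IntermediateField.adjoin ℚ ({β} : Set (AlgebraicClosure ℚ)))) * θI + (34435 : 𝓞 ↥(IntermediateField.adjoin ℚ ({β} : Set (AlgebraicClosure ℚ)))) * δI) * S₁ + (φ ((90508 : 𝓞 ↥(IntermediateField.adjoin ℚ ({β} : Set (AlgebraicClosure ℚ)))) + (-36420 : 𝓞 ↥(IntermediateField.adjoin ℚ ({β} : Set (AlgebraicClosure ℚ)))) * θI + (8688 : 𝓞 ↥(IntermediateField.adjoin ℚ ({β} : Set (AlgebraicClosure ℚ)))) * δI)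 + φ ((248095 : 𝓞 ↥(IntermediateField.adjoin ℚ ({β} : Set (AlgebraicClosure ℚ)))) + (-99832 : 𝓞 ↥(IntermediateField.adjoin ℚ ({β} : Set (AlgebraicClosure ℚ)))) * θI + (23815 : 𝓞 ↥(IntermediateField.adjoin ℚ ({β} : Set (AlgebraicClosure ℚ)))) * δI) * S₁) * S₂, by simp⟩
  have hm3 : ∀ (R : Type) [CommRing R] (φ : 𝓞 ↥(IntermediateField.adjoin ℚ ({β} : Set (AlgebraicClosure ℚ))) →+* R) (S₁ S₂ : R), S₁ ^ 2 = 2 → S₂ ^ 2 = 2 + S₁ →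
      ∃ c : ℕ → R, φ ((308215 : 𝓞 ↥(IntermediateField.adjoin ℚ ({β} : Set (AlgebraicClosure ℚ)))) + (-124024 : 𝓞 ↥(IntermediateField.adjoin ℚ ({β} : Set (AlgebraicClosure ℚ)))) * θI + (29586 : 𝓞 ↥(IntermediateField.adjoin ℚ ({β} : Set (AlgebraicClosure ℚ)))) * δI) + φ ((358730 : 𝓞 ↥(IntermediateField.adjoin ℚ ({β} : Set (AlgebraicClosure ℚ)))) + (-144351 : 𝓞 ↥(IntermediateField.adjoin ℚ ({β} : Set (AlgebraicClosure ℚ)))) * θI + (34435 : 𝓞 ↥(IntermediateField.adjoin ℚ ({β} : Set (AlgebraicClosure ℚ)))) * δI) * S₁ + (φ ((90508 : 𝓞 ↥(IntermediateField.adjoin ℚ ({β} : Set (AlgebraicClosure ℚ)))) + (-36420 : 𝓞 ↥(IntermediateField.adjoin ℚ ({β} : Set (AlgebraicClosure ℚ)))) * θI + (8688 : 𝓞 ↥(IntermediateField.adjoin ℚ ({β} : Set (AlgebraicClosure ℚ)))) * δI) + φ ((248095 : 𝓞 ↥(IntermediateField.adjoin ℚ ({β} : Set (AlgebraicClosure ℚ))))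 + (-99832 : 𝓞 ↥(IntermediateField.adjoin ℚ ({β} : Set (AlgebraicClosure ℚ)))) * θI + (23815 : 𝓞 ↥(IntermediateField.adjoin ℚ ({β} : Set (AlgebraicClosure ℚ)))) * δI) * S₁) * S₂ = ∑ k ∈ Finset.range (0 + 1), c k * φ ((-4667 : 𝓞 ↥(IntermediateField.adjoin ℚ ({β} : Set (AlgebraicClosure ℚ)))) + (1878 : 𝓞 ↥(IntermediateField.adjoin ℚ ({β} : Set (AlgebraicClosure ℚ)))) * θI + (-448 : 𝓞 ↥(IntermediateField.adjoin ℚ ({β} : Set (AlgebraicClosure ℚ)))) * δI) ^ (0 - k) * (S₂ - S₁ * S₂ - ((5 : ℤ) : R)) ^ k :=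
    fun R _ φ S₁ S₂ _ _ => ⟨fun _ => φ ((308215 : 𝓞 ↥(IntermediateField.adjoin ℚ ({β} : Set (AlgebraicClosure ℚ)))) + (-124024 : 𝓞 ↥(IntermediateField.adjoin ℚ ({β} : Set (AlgebraicClosure ℚ)))) * θI + (29586 : 𝓞 ↥(IntermediateField.adjoin ℚ ({β} : Set (AlgebraicClosure ℚ)))) * δI) + φ ((358730 : 𝓞 ↥(IntermediateField.adjoin ℚ ({β} : Set (AlgebraicClosure ℚ)))) + (-144351 : 𝓞 ↥(IntermediateField.adjoin ℚ ({β} : Set (AlgebraicClosure ℚ)))) * θI + (34435 : 𝓞 ↥(IntermediateField.adjoin ℚ ({β} : Set (AlgebraicClosure ℚ)))) * δI) * S₁ + (φ ((90508 : 𝓞 ↥(IntermediateField.adjoin ℚ ({β} : Set (AlgebraicClosure ℚ)))) + (-36420 : 𝓞 ↥(IntermediateField.adjoin ℚ ({β} : Set (AlgebraicClosure ℚ)))) * θI + (8688 : 𝓞 ↥(IntermediateField.adjoin ℚ ({β} : Set (AlgebraicClosure ℚ)))) * δI) + φ ((248095 : 𝓞 ↥(IntermediateField.adjoin ℚ ({β}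 : Set (AlgebraicClosure ℚ)))) + (-99832 : 𝓞 ↥(IntermediateField.adjoin ℚ ({β} : Set (AlgebraicClosure ℚ)))) * θI + (23815 : 𝓞 ↥(IntermediateField.adjoin ℚ ({β} : Set (AlgebraicClosure ℚ)))) * δI) * S₁) * S₂, by simp⟩
  -- residues of `δ`
  have hψδ : ψ δI = (3 : ZMod 17) := by
    have h := congrArg ψ hden
    simp only [map_mul, map_add, map_pow, map_one, map_ofNat, hψ] at h
    have h9 : (9 : ZMod 17) * 2 = 1 := by decide
    calc ψ δI = ((9 : ZMod 17) * 2) * ψ δI := by rw [h9, one_mul]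
      _ = (9 : ZMod 17) * (2 * ψ δI) := by ring
      _ = (3 : ZMod 17) := by rw [h]; decide
  have hχδ : χ δI = (1 : ZMod 5) := by
    have h := congrArg χ hden
    simp only [map_mul, map_add, map_pow, map_one, map_ofNat, hχ] at h
    have h9 : (3 : ZMod 5) * 2 = 1 := by decide
    calc χ δI = ((3 : ZMod 5) * 2) * χ δI := by rw [h9, one_mul]
      _ = (3 : ZMod 5) * (2 * χ δI) := by ring
      _ = (1 : ZMod 5) := by rw [h]; decide
  -- the unit `ε` and its inverse; `±ε` non-squares (at `χ`)
  have hεmul : ((-1226625 : 𝓞 ↥(IntermediateField.adjoin ℚ ({β} : Set (AlgebraicClosure ℚ)))) + (-3717338 : 𝓞 ↥(IntermediateField.adjoin ℚ ({β} : Set (AlgebraicClosure ℚ)))) * θI + (1697040 : 𝓞 ↥(IntermediateField.adjoin ℚ ({β} : Set (AlgebraicClosure ℚ)))) * δI) * ((108154177106367 : 𝓞 ↥(IntermediateField.adjoin ℚ ({β} : Set (AlgebraicClosure ℚ)))) + (-43520645237882 : 𝓞 ↥(IntermediateField.adjoin ℚ ({β} : Set (AlgebraicClosure ℚ)))) * θI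 + (10381875687608 : 𝓞 ↥(IntermediateField.adjoin ℚ ({β} : Set (AlgebraicClosure ℚ)))) * δI) = 1 := by
    linear_combination ((161780948327297798116 : 𝓞 ↥(IntermediateField.adjoin ℚ ({β} : Set (AlgebraicClosure ℚ))))) * hX2 + ((-112449216799316616784 : 𝓞 ↥(IntermediateField.adjoin ℚ ({β} : Set (AlgebraicClosure ℚ))))) * hXY + ((17618458316898280320 : 𝓞 ↥(IntermediateField.adjoin ℚ ({β} : Set (AlgebraicClosure ℚ))))) * hY2
  have hχε : χ ((-1226625 : 𝓞 ↥(IntermediateField.adjoin ℚ ({β} : Set (AlgebraicClosure ℚ)))) + (-3717338 : 𝓞 ↥(IntermediateField.adjoin ℚ ({β} : Set (AlgebraicClosure ℚ)))) * θI + (1697040 : 𝓞 ↥(IntermediateField.adjoin ℚ ({β} : Set (AlgebraicClosure ℚ)))) * δI) = (2 : ZMod 5) := by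
    simp only [map_add, map_mul, map_neg, map_ofNat, hχ, hχδ]; push_cast; decide
  have hnsq : ∀ z : (𝓞 ↥(IntermediateField.adjoin ℚ ({β} : Set (AlgebraicClosure ℚ))))ˣ, Units.mkOfMulEqOne _ _ hεmul ≠ z ^ 2 ∧ Units.mkOfMulEqOne _ _ hεmul ≠ -z ^ 2 := by
    intro z
    refine ⟨fun h => ?_, fun h => ?_⟩
    · have h' := congrArg (fun w : (𝓞 ↥(IntermediateField.adjoin ℚ ({β} : Set (AlgebraicClosure ℚ))))ˣ => χ (w : 𝓞 ↥(IntermediateField.adjoin ℚ ({β} : Set (AlgebraicClosure ℚ))))) h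
      simp only [Units.val_mkOfMulEqOne, Units.val_pow_eq_pow_val, map_pow] at h'
      rw [hχε] at h'
      exact absurd h'.symm (by generalize χ (z : 𝓞 ↥(IntermediateField.adjoin ℚ ({β} : Set (AlgebraicClosure ℚ)))) = u; revert u; decide)
    · have h' := congrArg (fun w : (𝓞 ↥(IntermediateField.adjoin ℚ ({β} : Set (AlgebraicClosure ℚ))))ˣ => χ (w : 𝓞 ↥(IntermediateField.adjoin ℚ ({β} : Set (AlgebraicClosure ℚ))))) h
      simp only [Units.val_mkOfMulEqOne, Units.val_neg, Units.val_pow_eq_pow_val, map_neg, map_pow] at h'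
      rw [hχε] at h'
      exact absurd h'.symm (by generalize χ (z : 𝓞 ↥(IntermediateField.adjoin ℚ ({β} : Set (AlgebraicClosure ℚ)))) = u; revert u; decide)
  -- congruences at the dyadic primes
  have hε : (Units.mkOfMulEqOne _ _ hεmul : (𝓞 ↥(IntermediateField.adjoin ℚ ({β} : Set (AlgebraicClosure ℚ))))ˣ).val - 1 ∈ Ideal.span {((136 : 𝓞 ↥(IntermediateField.adjoin ℚ ({β} : Set (AlgebraicClosure ℚ)))) + (458 : 𝓞 ↥(IntermediateField.adjoin ℚ ({β} : Set (AlgebraicClosure ℚ)))) * θI + (-337 : 𝓞 ↥(IntermediateField.adjoin ℚ ({β} : Set (AlgebraicClosure ℚ)))) * δI)} ^ 3 ∨ (Units.mkOfMulEqOne _ _ hεmul : (𝓞 ↥(IntermediateField.adjoin ℚ ({β} : Set (AlgebraicClosure ℚ))))ˣ).val + 1 ∈ Ideal.span {((136 : 𝓞 ↥(IntermediateField.adjoin ℚ ({β} : Set (AlgebraicClosure ℚ)))) + (458 : 𝓞 ↥(IntermediateField.adjoin ℚ ({β} : Set (AlgebraicClosure ℚ)))) * θI + (-337 : 𝓞 ↥(IntermediateField.adjoin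 ℚ ({β} : Set (AlgebraicClosure ℚ)))) * δI)} ^ 3 := by
    refine Or.inr ?_
    rw [Units.val_mkOfMulEqOne, Ideal.span_singleton_pow, Ideal.mem_span_singleton']
    exact ⟨((-31171318300121250965 : 𝓞 ↥(IntermediateField.adjoin ℚ ({β} : Set (AlgebraicClosure ℚ)))) + (12543166816409660584 : 𝓞 ↥(IntermediateField.adjoin ℚ ({β} : Set (AlgebraicClosure ℚ)))) * θI + (-2992179870153789343 : 𝓞 ↥(IntermediateField.adjoin ℚ ({β} : Set (AlgebraicClosure ℚ)))) * δI), by linear_combination ((777252082860693681398348136 : 𝓞 ↥(IntermediateField.adjoin ℚ ({β} : Set (AlgebraicClosure ℚ)))) + (10132300949525237704576910388 : 𝓞 ↥(IntermediateField.adjoin ℚ ({β} : Set (AlgebraicClosure ℚ)))) * δI + (2591839275409518494585790276 : 𝓞 ↥(IntermediateField.adjoin ℚ ({β} : Set (AlgebraicClosure ℚ)))) * δI ^ 2 + (-3126243390857106214176503880 : 𝓞 ↥(IntermediateField.adjoin ℚ ({β} : Set (AlgebraicClosure ℚ)))) * θI + (-2947511438535793235439573752 : 𝓞 ↥(IntermediateField.adjoin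 ℚ ({β} : Set (AlgebraicClosure ℚ)))) * θI * δI + (1205046018587429067575916608 : 𝓞 ↥(IntermediateField.adjoin ℚ ({β} : Set (AlgebraicClosure ℚ)))) * θI ^ 2) * hX2 + ((-1302642482000910309706110606 : 𝓞 ↥(IntermediateField.adjoin ℚ ({β} : Set (AlgebraicClosure ℚ)))) + (-6266276434601267409517675890 : 𝓞 ↥(IntermediateField.adjoin ℚ ({β} : Set (AlgebraicClosure ℚ)))) * δI + (-946972660577626380749227210 : 𝓞 ↥(IntermediateField.adjoin ℚ ({β} : Set (AlgebraicClosure ℚ)))) * δI ^ 2) * hXY + ((285119991575427302075458556 : 𝓞 ↥(IntermediateField.adjoin ℚ ({β} : Set (AlgebraicClosure ℚ)))) + (1296199436253425390428430798 : 𝓞 ↥(IntermediateField.adjoin ℚ ({β} : Set (AlgebraicClosure ℚ)))) * δI + (114518961101968051538671279 : 𝓞 ↥(IntermediateField.adjoin ℚ ({β} : Set (AlgebraicClosure ℚ)))) * δI ^ 2) * hY2⟩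
  have hε' : (Units.mkOfMulEqOne _ _ hεmul : (𝓞 ↥(IntermediateField.adjoin ℚ ({β} : Set (AlgebraicClosure ℚ))))ˣ).val - 3 ∈ Ideal.span {((1 : 𝓞 ↥(IntermediateField.adjoin ℚ ({β} : Set (AlgebraicClosure ℚ)))) + (3 : 𝓞 ↥(IntermediateField.adjoin ℚ ({β} : Set (AlgebraicClosure ℚ)))) * θI + (-1 : 𝓞 ↥(IntermediateField.adjoin ℚ ({β} : Set (AlgebraicClosure ℚ)))) * δI)} ^ 3 ∨ (Units.mkOfMulEqOne _ _ hεmul : (𝓞 ↥(IntermediateField.adjoin ℚ ({β} : Set (AlgebraicClosure ℚ))))ˣ).val + 3 ∈ Ideal.span {((1 : 𝓞 ↥(IntermediateField.adjoin ℚ ({β} : Set (AlgebraicClosure ℚ)))) + (3 : 𝓞 ↥(IntermediateField.adjoin ℚ ({β} : Set (AlgebraicClosure ℚ)))) * θI + (-1 : 𝓞 ↥(IntermediateField.adjoin ℚ ({β} : Set (AlgebraicClosure ℚ)))) * δI)} ^ 3 := by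
    refine Or.inl ?_
    rw [Units.val_mkOfMulEqOne, Ideal.span_singleton_pow, Ideal.mem_span_singleton']
    exact ⟨((66484 : 𝓞 ↥(IntermediateField.adjoin ℚ ({β} : Set (AlgebraicClosure ℚ)))) + (-34618 : 𝓞 ↥(IntermediateField.adjoin ℚ ({β} : Set (AlgebraicClosure ℚ)))) * θI + (7576 : 𝓞 ↥(IntermediateField.adjoin ℚ ({β} : Set (AlgebraicClosure ℚ)))) * δI), by linear_combination ((-311562 : 𝓞 ↥(IntermediateField.adjoin ℚ ({β} : Set (AlgebraicClosure ℚ)))) + (-3976002 : 𝓞 ↥(IntermediateField.adjoin ℚ ({β} : Set (AlgebraicClosure ℚ)))) * δI + (-516114 : 𝓞 ↥(IntermediateField.adjoin ℚ ({β} : Set (AlgebraicClosure ℚ)))) * δI ^ 2 + (1795068 : 𝓞 ↥(IntermediateField.adjoin ℚ ({β} : Set (AlgebraicClosure ℚ)))) * θI + (1139238 : 𝓞 ↥(IntermediateField.adjoin ℚ ({β} : Set (AlgebraicClosure ℚ)))) * θI * δI + (-934686 : 𝓞 ↥(IntermediateField.adjoin ℚ ({β} : Set (AlgebraicClosure ℚ))))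 * θI ^ 2) * hX2 + ((713302 : 𝓞 ↥(IntermediateField.adjoin ℚ ({β} : Set (AlgebraicClosure ℚ)))) + (2225402 : 𝓞 ↥(IntermediateField.adjoin ℚ ({β} : Set (AlgebraicClosure ℚ)))) * δI + (102802 : 𝓞 ↥(IntermediateField.adjoin ℚ ({β} : Set (AlgebraicClosure ℚ)))) * δI ^ 2) * hXY + ((-86672 : 𝓞 ↥(IntermediateField.adjoin ℚ ({β} : Set (AlgebraicClosure ℚ)))) + (-427816 : 𝓞 ↥(IntermediateField.adjoin ℚ ({β} : Set (AlgebraicClosure ℚ)))) * δI + (-7576 : 𝓞 ↥(IntermediateField.adjoin ℚ ({β} : Set (AlgebraicClosure ℚ)))) * δI ^ 2) * hY2⟩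
  have hπ : ((-4667 : 𝓞 ↥(IntermediateField.adjoin ℚ ({β} : Set (AlgebraicClosure ℚ)))) + (1878 : 𝓞 ↥(IntermediateField.adjoin ℚ ({β} : Set (AlgebraicClosure ℚ)))) * θI + (-448 : 𝓞 ↥(IntermediateField.adjoin ℚ ({β} : Set (AlgebraicClosure ℚ)))) * δI) - 3 ∈ Ideal.span {((136 : 𝓞 ↥(IntermediateField.adjoin ℚ ({β} : Set (AlgebraicClosure ℚ)))) + (458 : 𝓞 ↥(IntermediateField.adjoin ℚ ({β} : Set (AlgebraicClosure ℚ)))) * θI + (-337 : 𝓞 ↥(IntermediateField.adjoin ℚ ({β} : Set (AlgebraicClosure ℚ)))) * δI)} ^ 3 ∨ ((-4667 : 𝓞 ↥(IntermediateField.adjoin ℚ ({β} : Set (AlgebraicClosure ℚ)))) + (1878 : 𝓞 ↥(IntermediateField.adjoin ℚ ({β} : Set (AlgebraicClosure ℚ)))) * θI + (-448 : 𝓞 ↥(IntermediateField.adjoin ℚ ({β} : Set (AlgebraicClosure ℚ)))) * δI) + 3 ∈ Ideal.span {((136 : 𝓞 ↥(IntermediateField.adjoin ℚ ({β} : Set (AlgebraicClosure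 ℚ)))) + (458 : 𝓞 ↥(IntermediateField.adjoin ℚ ({β} : Set (AlgebraicClosure ℚ)))) * θI + (-337 : 𝓞 ↥(IntermediateField.adjoin ℚ ({β} : Set (AlgebraicClosure ℚ)))) * δI)} ^ 3 := by
    refine Or.inr ?_
    rw [Ideal.span_singleton_pow, Ideal.mem_span_singleton']
    exact ⟨((166208700198445390219312 : 𝓞 ↥(IntermediateField.adjoin ℚ ({β} : Set (AlgebraicClosure ℚ)))) + (-66881465610635163426190 : 𝓞 ↥(IntermediateField.adjoin ℚ ({β} : Set (AlgebraicClosure ℚ)))) * θI + (15954613218148040805320 : 𝓞 ↥(IntermediateField.adjoin ℚ ({β} : Set (AlgebraicClosure ℚ)))) * δI), by linear_combination ((-4144388670860537831016887346160 : 𝓞 ↥(IntermediateField.adjoin ℚ ({β} : Set (AlgebraicClosure ℚ)))) + (-54026478913261523145556536059528 : 𝓞 ↥(IntermediateField.adjoin ℚ ({β} : Set (AlgebraicClosure ℚ)))) * δI + (-13819955670191238271888190748420 : 𝓞 ↥(IntermediateField.adjoin ℚ ({β} : Set (AlgebraicClosure ℚ)))) * δI ^ 2 + (16669453806716891787001969122544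 : 𝓞 ↥(IntermediateField.adjoin ℚ ({β} : Set (AlgebraicClosure ℚ)))) * θI + (15716436510713071818782675842600 : 𝓞 ↥(IntermediateField.adjoin ℚ ({β} : Set (AlgebraicClosure ℚ)))) * θI * δI + (-6425430278575967684786544175280 : 𝓞 ↥(IntermediateField.adjoin ℚ ({β} : Set (AlgebraicClosure ℚ)))) * θI ^ 2) * hX2 + ((6945824737730322720987014468082 : 𝓞 ↥(IntermediateField.adjoin ℚ ({β} : Set (AlgebraicClosure ℚ)))) + (33412435471975981738662904931662 : 𝓞 ↥(IntermediateField.adjoin ℚ ({β} : Set (AlgebraicClosure ℚ)))) * δI + (5049356383411562341630641448990 : 𝓞 ↥(IntermediateField.adjoin ℚ ({β} : Set (AlgebraicClosure ℚ)))) * δI ^ 2) * hXY + ((-1520289348819717235358252676744 : 𝓞 ↥(IntermediateField.adjoin ℚ ({β} : Set (AlgebraicClosure ℚ)))) + (-6911469749959259350372553239296 : 𝓞 ↥(IntermediateField.adjoin ℚ ({β} : Set (AlgebraicClosure ℚ)))) * δI + (-610626970908715083175933445960 : 𝓞 ↥(IntermediateField.adjoin ℚ ({β} : Set (AlgebraicClosure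 ℚ)))) * δI ^ 2) * hY2⟩
  have hψq : ψ ((-4667 : 𝓞 ↥(IntermediateField.adjoin ℚ ({β} : Set (AlgebraicClosure ℚ)))) + (1878 : 𝓞 ↥(IntermediateField.adjoin ℚ ({β} : Set (AlgebraicClosure ℚ)))) * θI + (-448 : 𝓞 ↥(IntermediateField.adjoin ℚ ({β} : Set (AlgebraicClosure ℚ)))) * δI) = 0 := by
    simp only [map_add, map_mul, map_neg, map_ofNat, hψ, hψδ]; push_cast; decide
  have hεy : ((1 : 𝓞 ↥(IntermediateField.adjoin ℚ ({β} : Set (AlgebraicClosure ℚ)))) + (0 : 𝓞 ↥(IntermediateField.adjoin ℚ ({β} : Set (AlgebraicClosure ℚ)))) * θI + (0 : 𝓞 ↥(IntermediateField.adjoin ℚ ({β} : Set (AlgebraicClosure ℚ)))) * δI) * ((1 : 𝓞 ↥(IntermediateField.adjoin ℚ ({β} : Set (AlgebraicClosure ℚ)))) + (0 : 𝓞 ↥(IntermediateField.adjoin ℚ ({β} : Set (AlgebraicClosure ℚ)))) * θI + (0 : 𝓞 ↥(IntermediateField.adjoin ℚ ({β} : Set (AlgebraicClosure ℚ)))) *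 δI) = 1 := by
    linear_combination ((0 : 𝓞 ↥(IntermediateField.adjoin ℚ ({β} : Set (AlgebraicClosure ℚ))))) * hX2 + ((0 : 𝓞 ↥(IntermediateField.adjoin ℚ ({β} : Set (AlgebraicClosure ℚ))))) * hXY + ((0 : 𝓞 ↥(IntermediateField.adjoin ℚ ({β} : Set (AlgebraicClosure ℚ))))) * hY2
  exact AlignedTransportAtTwoCubicSplitStratumLayerTwoGeneralRelationDoor.classicalMuVanishes_adjoin_of_generalRelationCert_layer_two_splitStratum ((⟨1, 1, 0, -430, -15761⟩ : WeierstrassCurve ℤ).baseChange ℚ) hord ht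
    minimalDiscriminantInt_emod_eight_n12261 Δ_n12261_neg hβ (not_two_dvd_classNumber_cubicField_n12261 hβ) hd
    (Ideal.span {((1 : 𝓞 ↥(IntermediateField.adjoin ℚ ({β} : Set (AlgebraicClosure ℚ)))) + (3 : 𝓞 ↥(IntermediateField.adjoin ℚ ({β} : Set (AlgebraicClosure ℚ)))) * θI + (-1 : 𝓞 ↥(IntermediateField.adjoin ℚ ({β} : Set (AlgebraicClosure ℚ)))) * δI)}) hN' hε' (Ideal.span {((136 : 𝓞 ↥(IntermediateField.adjoin ℚ ({β} : Set (AlgebraicClosure ℚ)))) + (458 : 𝓞 ↥(IntermediateField.adjoin ℚ ({β} : Set (AlgebraicClosure ℚ)))) * θI + (-337 : 𝓞 ↥(IntermediateField.adjoin ℚ ({β} : Set (AlgebraicClosure ℚ)))) * δI)}) hN1 hε hnsq κP hκP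
    ((-4667 : 𝓞 ↥(IntermediateField.adjoin ℚ ({β} : Set (AlgebraicClosure ℚ)))) + (1878 : 𝓞 ↥(IntermediateField.adjoin ℚ ({β} : Set (AlgebraicClosure ℚ)))) * θI + (-448 : 𝓞 ↥(IntermediateField.adjoin ℚ ({β} : Set (AlgebraicClosure ℚ)))) * δI) hmax hπ 5 (q := 17) (by norm_num) ψ hψq (ti := 9) (by decide) (by decide)
    ((-38894531512346941166 : 𝓞 ↥(IntermediateField.adjoin ℚ ({β} : Set (AlgebraicClosure ℚ)))) + (-54406496968953817710 : 𝓞 ↥(IntermediateField.adjoin ℚ ({β} : Set (AlgebraicClosure ℚ)))) * θI + (-152233013698462976009 : 𝓞 ↥(IntermediateField.adjoin ℚ ({β} : Set (AlgebraicClosure ℚ)))) * δI) ((-235447071839344745763 : 𝓞 ↥(IntermediateField.adjoin ℚ ({β} : Set (AlgebraicClosure ℚ)))) + (94742622868543320204 : 𝓞 ↥(IntermediateField.adjoin ℚ ({β} : Set (AlgebraicClosure ℚ)))) * θI + (-22600910691331368217 : 𝓞 ↥(IntermediateField.adjoin ℚ ({β} : Set (AlgebraicClosure ℚ)))) * δI)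 (by push_cast; linear_combination ((50805709490117080140029763094434672 : 𝓞 ↥(IntermediateField.adjoin ℚ ({β} : Set (AlgebraicClosure ℚ)))) + (-62168102397932880088283249735132616 : 𝓞 ↥(IntermediateField.adjoin ℚ ({β} : Set (AlgebraicClosure ℚ)))) * δI + (-16559148687732584574523902684670752 : 𝓞 ↥(IntermediateField.adjoin ℚ ({β} : Set (AlgebraicClosure ℚ)))) * δI ^ 2 + (-609809151450036317377477804130304 : 𝓞 ↥(IntermediateField.adjoin ℚ ({β} : Set (AlgebraicClosure ℚ)))) * δI ^ 3 + (-27187572307212354581713805178435408 : 𝓞 ↥(IntermediateField.adjoin ℚ ({β} : Set (AlgebraicClosure ℚ)))) * θI + (14364814442736742626486306300667632 : 𝓞 ↥(IntermediateField.adjoin ℚ ({β} : Set (AlgebraicClosure ℚ)))) * θI * δI + (1575824895802377236839100786436096 : 𝓞 ↥(IntermediateField.adjoin ℚ ({β} : Set (AlgebraicClosure ℚ)))) * θI * δI ^ 2 + (6920167145473669449487191853362624 : 𝓞 ↥(IntermediateField.adjoin ℚ ({β} : Set (AlgebraicClosure ℚ)))) * θI ^ 2 + (-1247846338302177985303642170520464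 : 𝓞 ↥(IntermediateField.adjoin ℚ ({β} : Set (AlgebraicClosure ℚ)))) * θI ^ 2 * δI + (-676757559987364925015348505665760 : 𝓞 ↥(IntermediateField.adjoin ℚ ({β} : Set (AlgebraicClosure ℚ)))) * θI ^ 3) * hX2 + ((8439063036224555565416203877931504 : 𝓞 ↥(IntermediateField.adjoin ℚ ({β} : Set (AlgebraicClosure ℚ)))) + (44917748537024367215495496732276480 : 𝓞 ↥(IntermediateField.adjoin ℚ ({β} : Set (AlgebraicClosure ℚ)))) * δI + (5932824408540172200635065540792320 : 𝓞 ↥(IntermediateField.adjoin ℚ ({β} : Set (AlgebraicClosure ℚ)))) * δI ^ 2 + (100633332645479464290960304766976 : 𝓞 ↥(IntermediateField.adjoin ℚ ({β} : Set (AlgebraicClosure ℚ)))) * δI ^ 3) * hXY + ((-2900449724585153179279133013635152 : 𝓞 ↥(IntermediateField.adjoin ℚ ({β} : Set (AlgebraicClosure ℚ)))) + (-8697935699964859963282189327021632 : 𝓞 ↥(IntermediateField.adjoin ℚ ({β} : Set (AlgebraicClosure ℚ)))) * δI + (-812689770381821102558636790710272 : 𝓞 ↥(IntermediateField.adjoin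 ℚ ({β} : Set (AlgebraicClosure ℚ)))) * δI ^ 2 + (-6132264813713323391830452076544 : 𝓞 ↥(IntermediateField.adjoin ℚ ({β} : Set (AlgebraicClosure ℚ)))) * δI ^ 3) * hY2)
    ((-1073 : 𝓞 ↥(IntermediateField.adjoin ℚ ({β} : Set (AlgebraicClosure ℚ)))) + (-2886 : 𝓞 ↥(IntermediateField.adjoin ℚ ({β} : Set (AlgebraicClosure ℚ)))) * θI + (296 : 𝓞 ↥(IntermediateField.adjoin ℚ ({β} : Set (AlgebraicClosure ℚ)))) * δI) ((6 : 𝓞 ↥(IntermediateField.adjoin ℚ ({β} : Set (AlgebraicClosure ℚ))))) (by push_cast; linear_combination ((-5419908 : 𝓞 ↥(IntermediateField.adjoin ℚ ({β} : Set (AlgebraicClosure ℚ))))) * hX2 + ((1848816 : 𝓞 ↥(IntermediateField.adjoin ℚ ({β} : Set (AlgebraicClosure ℚ))))) * hXY + ((-132608 : 𝓞 ↥(IntermediateField.adjoin ℚ ({β} : Set (AlgebraicClosure ℚ))))) * hY2)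
    ((87 : 𝓞 ↥(IntermediateField.adjoin ℚ ({β} : Set (AlgebraicClosure ℚ)))) + (234 : 𝓞 ↥(IntermediateField.adjoin ℚ ({β} : Set (AlgebraicClosure ℚ)))) * θI + (-24 : 𝓞 ↥(IntermediateField.adjoin ℚ ({β} : Set (AlgebraicClosure ℚ)))) * δI) ((5 : 𝓞 ↥(IntermediateField.adjoin ℚ ({β} : Set (AlgebraicClosure ℚ))))) (by push_cast; linear_combination ((439452 : 𝓞 ↥(IntermediateField.adjoin ℚ ({β} : Set (AlgebraicClosure ℚ))))) * hX2 + ((-149904 : 𝓞 ↥(IntermediateField.adjoin ℚ ({β} : Set (AlgebraicClosure ℚ))))) * hXY + ((10752 : 𝓞 ↥(IntermediateField.adjoin ℚ ({β} : Set (AlgebraicClosure ℚ))))) * hY2)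
    ((2552 : 𝓞 ↥(IntermediateField.adjoin ℚ ({β} : Set (AlgebraicClosure ℚ)))) + (6864 : 𝓞 ↥(IntermediateField.adjoin ℚ ({β} : Set (AlgebraicClosure ℚ)))) * θI + (-704 : 𝓞 ↥(IntermediateField.adjoin ℚ ({β} : Set (AlgebraicClosure ℚ)))) * δI) ((13 : 𝓞 ↥(IntermediateField.adjoin ℚ ({β} : Set (AlgebraicClosure ℚ))))) (by push_cast; linear_combination ((12890592 : 𝓞 ↥(IntermediateField.adjoin ℚ ({β} : Set (AlgebraicClosure ℚ))))) * hX2 + ((-4397184 : 𝓞 ↥(IntermediateField.adjoin ℚ ({β} : Set (AlgebraicClosure ℚ))))) * hXY + ((315392 : 𝓞 ↥(IntermediateField.adjoin ℚ ({β} : Set (AlgebraicClosure ℚ))))) * hY2)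
    3 1 0 0 (n := 4) (d := 1) (by norm_num) (by norm_num) (u := 1) (g := (C (2 : ℤ) : ℤ[X])) (by norm_num)
    (by simp only [eq_intCast]; push_cast; ring)
    ((308215 : 𝓞 ↥(IntermediateField.adjoin ℚ ({β} : Set (AlgebraicClosure ℚ)))) + (-124024 : 𝓞 ↥(IntermediateField.adjoin ℚ ({β} : Set (AlgebraicClosure ℚ)))) * θI + (29586 : 𝓞 ↥(IntermediateField.adjoin ℚ ({β} : Set (AlgebraicClosure ℚ)))) * δI) ((358730 : 𝓞 ↥(IntermediateField.adjoin ℚ ({β} : Set (AlgebraicClosure ℚ)))) + (-144351 : 𝓞 ↥(IntermediateField.adjoin ℚ ({β} : Set (AlgebraicClosure ℚ)))) * θI + (34435 : 𝓞 ↥(IntermediateField.adjoin ℚ ({β} : Set (AlgebraicClosure ℚ)))) * δI) ((90508 : 𝓞 ↥(IntermediateField.adjoin ℚ ({β} : Set (AlgebraicClosure ℚ)))) + (-36420 : 𝓞 ↥(IntermediateField.adjoin ℚ ({β} : Set (AlgebraicClosure ℚ)))) * θI + (8688 : 𝓞 ↥(IntermediateField.adjoin ℚ ({β} : Set (AlgebraicClosure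 ℚ)))) * δI) ((248095 : 𝓞 ↥(IntermediateField.adjoin ℚ ({β} : Set (AlgebraicClosure ℚ)))) + (-99832 : 𝓞 ↥(IntermediateField.adjoin ℚ ({β} : Set (AlgebraicClosure ℚ)))) * θI + (23815 : 𝓞 ↥(IntermediateField.adjoin ℚ ({β} : Set (AlgebraicClosure ℚ)))) * δI) hm0 hm1 hm2 hm3
    (Units.mkOfMulEqOne _ _ hεy) (by rw [Units.val_mkOfMulEqOne]; linear_combination ((-4292151155288 : 𝓞 ↥(IntermediateField.adjoin ℚ ({β} : Set (AlgebraicClosure ℚ)))) + (1061270839752 : 𝓞 ↥(IntermediateField.adjoin ℚ ({β} : Set (AlgebraicClosure ℚ)))) * δI + (152587223224 : 𝓞 ↥(IntermediateField.adjoin ℚ ({β} : Set (AlgebraicClosure ℚ)))) * δI ^ 2 + (1515950233804 : 𝓞 ↥(IntermediateField.adjoin ℚ ({β} : Set (AlgebraicClosure ℚ)))) * θI + (-121521736592 : 𝓞 ↥(IntermediateField.adjoin ℚ ({β} : Set (AlgebraicClosure ℚ)))) * θI * δI + (-191468140172 : 𝓞 ↥(IntermediateField.adjoin ℚ ({β}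 : Set (AlgebraicClosure ℚ)))) * θI ^ 2) * hX2 + ((500051238816 : 𝓞 ↥(IntermediateField.adjoin ℚ ({β} : Set (AlgebraicClosure ℚ)))) + (-902764862560 : 𝓞 ↥(IntermediateField.adjoin ℚ ({β} : Set (AlgebraicClosure ℚ)))) * δI + (-41656697008 : 𝓞 ↥(IntermediateField.adjoin ℚ ({β} : Set (AlgebraicClosure ℚ)))) * δI ^ 2) * hXY + ((-22131020976 : 𝓞 ↥(IntermediateField.adjoin ℚ ({β} : Set (AlgebraicClosure ℚ)))) + (164487048532 : 𝓞 ↥(IntermediateField.adjoin ℚ ({β} : Set (AlgebraicClosure ℚ)))) * δI + (3523744636 : 𝓞 ↥(IntermediateField.adjoin ℚ ({β} : Set (AlgebraicClosure ℚ)))) * δI ^ 2) * hY2)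

/-- ★★ **`μ₂(κ) = 0` — UNCONDITIONAL — for every cyclotomic `ℤ₂`-extension `κ` of the cubic `2`-torsion field of `⟨1, 1, 0, -430, -15761⟩`** (field `−4087`), by the
split-stratum general layer-two relation road. [cite: Washington1997, §13.3] [cite: LMFDB, number field 3.1.4087.1] -/
theorem classicalMuVanishes_cubicField_n12261_unconditional {β : AlgebraicClosure ℚ} (hβ : aeval β ((⟨1, 1, 0, -430, -15761⟩ : WeierstrassCurve ℤ).baseChange ℚ).twoTorsionPolynomial.toPoly = 0)
    (κP : ZpExtension ↥(IntermediateField.adjoin ℚ ({β} : Set (AlgebraicClosure ℚ))) 2) (hκP : κP.IsCyclotomic) : ClassicalMuVanishes κP :=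
  (classGroupPRank_le_and_mu_lambda_cubicField_n12261 hβ κP hκP).2.1

/-! ## §4 `MC₂(W)` at the seed modulo PRINT (att-p5 g24's cubic carrier road with its `μ₂ = 0` input DISCHARGED) -/

/-- The `2`-division cubic of `⟨1, 1, 0, -430, -15761⟩` has a root in `ℚ̄`. [cite: SilvermanAEC2009, III.1] -/
theorem exists_root_twoTorsionPolynomial_n12261 :
    ∃ β : AlgebraicClosure ℚ, aeval β ((⟨1, 1, 0, -430, -15761⟩ : WeierstrassCurve ℤ).baseChange ℚ).twoTorsionPolynomial.toPoly = 0 := by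
  apply IsAlgClosed.exists_aeval_eq_zero
  rw [Cubic.degree_of_a_ne_zero (by simp [WeierstrassCurve.twoTorsionPolynomial])]
  decide

/-- ★ **`C2` AT THE SEED `⟨1, 1, 0, -430, -15761⟩` (`N = 12261`) modulo PRINT⁵ + MuIneqʳ + the crux's own hypotheses at this `W`** — att-p5 g24's carrier road with its
`μ₂ = 0` input DISCHARGED by the split-stratum layer-two relation row.  CONDITIONAL; BSD is NOT proved; nothing is closed.
[cite: Kato2004Asterisque, Thm. 17.4 (1)(2) (p. 273)] [cite: GreenbergLNM1716, Thm. 4.1 (p. 102) and Conj. 1.11 (p. 58)] [cite: Iwasawa1973MuInvariants, Thm. 2 and Thm. 3] -/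
theorem mazurMainConjecture_two_n12261_of_print
    [((⟨1, 1, 0, -430, -15761⟩ : WeierstrassCurve ℤ).baseChange ℚ).IsElliptic] [((⟨1, 1, 0, -430, -15761⟩ : WeierstrassCurve ℤ).baseChange ℚ).IsGloballyMinimal]
    (h17 : ∀ [NeZero (((⟨1, 1, 0, -430, -15761⟩ : WeierstrassCurve ℤ).baseChange ℚ).conductorNorm ℤ)] (f : CuspForm (Gamma0 (((⟨1, 1, 0, -430, -15761⟩ : WeierstrassCurve ℤ).baseChange ℚ).conductorNorm ℤ)) 2),
      kato_divisibility_allPrimes ((⟨1, 1, 0, -430, -15761⟩ : WeierstrassCurve ℤ).baseChange ℚ) 2 (f := f))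
    (hGr : Greenberg1999.thm41_charValue_rankZero_anyPrime)
    (hper : realPeriodRat_eq_unit_mul_plusPeriod_two) (hmod : nonempty_modularParametrizationData)
    (hGZK : rank_eq_analyticRank_of_analyticRank_le_one)
    (hI : ∀ (W : WeierstrassCurve ℚ) [W.IsElliptic] [W.IsGloballyMinimal], IsOrdinaryAt W 2 →
      (∀ x : ℚ, ¬ HasRationalTwoTorsionX W x) →
      ∀ (κ : ZpExtension ℚ 2) (γ : Field.absoluteGaloisGroup ℚ), κ.IsCyclotomic →
      κ.IsTopGenerator γ → IsCyclotomicVariable 2 γ →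
      ∀ ⦃N : ℕ⦄ [NeZero N] (f : CuspForm (Gamma0 N) 2), IsNewformOf W f →
      ∀ Gp : IwasawaAlgebra 2, iwasawaToPowerSeries 2 Gp = padicLFunction f (unitRoot W 2 : ℚ_[2]) →
      ∀ (D : W.SelmerDualData κ γ) (Yr : W.FineSelmerDualDataRelaxedInf κ γ),
        lengthAt (IwasawaAlgebra 2) D.X ⟨IwasawaAlgebra.augIdealP 2, IwasawaAlgebra.isPrime_augIdealP_holds 2⟩ ≤
          lengthAt (IwasawaAlgebra 2) (IwasawaAlgebra 2 ⧸ Ideal.span {Gp})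
              ⟨IwasawaAlgebra.augIdealP 2, IwasawaAlgebra.isPrime_augIdealP_holds 2⟩ +
            lengthAt (IwasawaAlgebra 2) Yr.X ⟨IwasawaAlgebra.augIdealP 2, IwasawaAlgebra.isPrime_augIdealP_holds 2⟩)
    (hr : ((⟨1, 1, 0, -430, -15761⟩ : WeierstrassCurve ℤ).baseChange ℚ).analyticRank = 0)
    (hμan : ∀ ⦃N : ℕ⦄ [NeZero N] (f : CuspForm (Gamma0 N) 2), IsNewformOf ((⟨1, 1, 0, -430, -15761⟩ : WeierstrassCurve ℤ).baseChange ℚ) f →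
      ∀ G : IwasawaAlgebra 2, IsEvenBranchLiftAtTwo ((⟨1, 1, 0, -430, -15761⟩ : WeierstrassCurve ℤ).baseChange ℚ) f G → red G ≠ 0)
    (hbsd : BSDp ((⟨1, 1, 0, -430, -15761⟩ : WeierstrassCurve ℤ).baseChange ℚ) 2) :
    MazurMainConjecture ((⟨1, 1, 0, -430, -15761⟩ : WeierstrassCurve ℤ).baseChange ℚ) 2 := by
  obtain ⟨β, hβ⟩ := exists_root_twoTorsionPolynomial_n12261
  have hord : IsOrdinaryAt ((⟨1, 1, 0, -430, -15761⟩ : WeierstrassCurve ℤ).baseChange ℚ) 2 := goodOrd_two_n12261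
  exact mazurMainConjecture_two_of_muIneqRel_of_classicalMu_cubicField_of_Δ_neg ((⟨1, 1, 0, -430, -15761⟩ : WeierstrassCurve ℤ).baseChange ℚ) h17 hGr hper hmod hGZK hI hord
    not_hasRationalTwoTorsionX_n12261 Δ_n12261_neg hr hμan hbsd hβ (fun κP hκP =>
      (classGroupPRank_le_and_mu_lambda_cubicField_n12261 hβ κP hκP).2.1)

end Summit.BirchSwinnertonDyer.BirchSwinnertonDyer.Theorems.AlignedTransportAtTwoCubicSplitStratumLayerTwoGeneralRelationRowN12261

end

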